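import Mathlib.Analysis.Analytic.Order
import Mathlib.Analysis.Calculus.IteratedDeriv.Defs
import Mathlib.Analysis.Complex.Basic
import Literature.Analysis.Complex.DeBruijnUniversalFactors
import HarnessLib

/-!
# The Fourier–Pólya count of Ki and Kim for even real entire functions (Ki–Kim 2000, Thm 4.3)

Named fact (D-0014) for route `RiemannHypothesis/EarlyAppointments` (target
`EarlyAppointments.HereditaryLaguerre` = stmt-RiemannHypothesis-3182, assembly
stmt-RiemannHypothesis-3189), stated over the tree's `IsEntireOfOrderLt`, `IsRealOnReal`
(`DeBruijnUniversalFactors.lean`) and Mathlib's `iteratedDeriv`, `analyticOrderNatAt`.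

H. Ki and Y.-O. Kim, *On the number of nonreal zeros of real entire functions and the
Fourier–Pólya conjecture*, Duke Math. J. 104 (2000) 45–73, prove the Fourier–Pólya conjecture
(Thm 4.1, genus 0) and two extensions. We vendor the one that applies to Riemann's `Ξ`:

> **Theorem 4.3** (p. 63). Let `f(x)` be an even or odd real entire function of growth `(2, 0)`,
> let `b₁, b₂, …` denote the real zeros of `f(x)` that are different from zero, and suppose that
> `∑ⱼ bⱼ⁻² < ∞` (4.10). Then for each nonnegative real constant `α`, the function `e^{-αx²} f(x)`
> has just as many critical points as couples of nonreal zeros.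

Here (p. 50, Boas' notation) "growth `(ρ, τ)`" means order `< ρ`, or order `ρ` and type `≤ τ`;
"critical points" are Fourier's (p. 46, (1.1)): for `l ≥ 1` and a zero `c` of `f^{(l)}` of
multiplicity `m` (`f^{(l)}(c) = ⋯ = f^{(l+m-1)}(c) = 0 ≠ f^{(l+m)}(c)`), put `k = 0` if
`f^{(l-1)}(c) = 0`, else `k = m/2` (`m` even), `(m+1)/2` (`m` odd, `f^{(l-1)}(c) f^{(l+m)}(c) > 0`),
`(m-1)/2` (`m` odd, `f^{(l-1)}(c) f^{(l+m)}(c) < 0`); `f^{(l)}` has `k` critical zeros at `c`, and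
"a point is a critical point of `f` if some derivative of `f` has a critical zero at the point";
the count is with multiplicity `k` ("cosh x has infinitely many critical points at the origin"),
and "just as many … as couples of nonreal zeros" includes the INFINITE case: the proof of
Thm 4.3 (pp. 63–65, class 𝒩) — like that of Thm 4.1 (p. 60: "we may assume that `f(x)` has
infinitely many nonreal zeros. Then we must show that `f(x)` has infinitely many critical
points") — treats functions with infinitely many nonreal zeros.

## What is vendored (a literal special case, weaker than print)

`KiKim2000_thm_4_3_noCriticalPoints`: the case "ZERO critical points ⟹ ZERO nonreal zeros" of
Theorem 4.3 with `α = 0`, for EVEN `f` of order `< 2` (⟹ growth `(2,0)`):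
if no derivative of `fℝ = Re f|ℝ` has a critical zero, then every zero of `f` is real.
"No critical zero anywhere" is rendered through (1.1): at a zero `c` of `fℝ^{(l+1)}` with
`fℝ^{(l)}(c) ≠ 0` one has `k = 0` iff `m = 1` and `fℝ^{(l)}(c) fℝ^{(l+2)}(c) < 0`, i.e. iff
`fℝ^{(l)}(c) · fℝ^{(l+2)}(c) < 0` (this forces `fℝ^{(l+2)}(c) ≠ 0`, i.e. `m = 1`; for `m ≥ 2`,
`k ≥ 1`); at zeros with `fℝ^{(l)}(c) = 0`, `k = 0` by definition. Zeros of infinite multiplicity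
(a derivative vanishing identically, i.e. `f` a polynomial) make the hypothesis fail, so nothing
is claimed there. Hypothesis (4.10) is kept verbatim (real nonzero zeros with multiplicity
`analyticOrderNatAt`), although for order `< 2` it is automatic (exponent of convergence).

Consequence recorded for the route (NOT asserted here): with `f = riemannXiUpper` (even, order 1,
`∑ γ⁻² < ∞`), the route's target `HereditaryLaguerre` is exactly the hypothesis below, so
`HereditaryLaguerre → RH` follows from this fact and
`riemannHypothesis_iff_im_eq_zero_of_riemannXiUpper_eq_zero_holds` — the converse
`RH → HereditaryLaguerre` being Laguerre–Pólya heredity; i.e. the target is a KNOWN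
RH-equivalent (Fourier–Pólya form of RH).

What is NOT here: the full counting statement (needs a cardinal-valued count of critical points),
the odd case and `α > 0`, Thm 4.2 (order ≤ 1 minimal type, real-zero reciprocal sum convergent),
Thm 4.1, the Pólya–Wiman theorem (Thm 2.1; Craven–Csordas–Smith 1987, Kim 1990) — the tree has
the related PROVED Jensen-disc heredity `Literature.Analysis.Complex.abs_im_le_of_iteratedDeriv_eq_zero`
and Kim's theorem as printed by Farmer (`Farmer2022_kimTheorem_holds`).

## References

* H. Ki, Y.-O. Kim, Duke Math. J. 104 (2000) 45–73, (1.1) p. 46, Thm 4.3 p. 63 [KiKim2000].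
* Y.-O. Kim, Proc. AMS 124 (1996) 819–830 [Kim1996].
-/

noncomputable section

namespace Literature.Analysis.Complex

/-- **Fourier's critical points, absence of** (Ki–Kim 2000, (1.1), the case `k = 0` everywhere):
the real function `g` has NO critical point in the sense of Fourier–Ki–Kim iff at every zero `c`
of every derivative `g^{(l+1)}` (`l ≥ 0`) at which `g^{(l)}(c) ≠ 0`, the zero is simple with the
Laguerre sign, `g^{(l)}(c) · g^{(l+2)}(c) < 0` (by (1.1): for such `c` of multiplicity `m`,
`k = 0 ⟺ m = 1 ∧ g^{(l)}(c) g^{(l+2)}(c) < 0`; zeros with `g^{(l)}(c) = 0` have `k = 0` by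
definition). This is the shape of the route decl `EarlyAppointments.HereditaryLaguerre`.
[cite: KiKim2000, (1.1) p. 46] -/
def HasNoFourierCriticalPoint (g : ℝ → ℝ) : Prop :=
  ∀ (l : ℕ) (c : ℝ), iteratedDeriv (l + 1) g c = 0 → iteratedDeriv l g c ≠ 0 →
    iteratedDeriv l g c * iteratedDeriv (l + 2) g c < 0

/-- **Ki–Kim 2000, Theorem 4.3 — the case of no critical points, `α = 0`, even `f`.** Let
`f : ℂ → ℂ` be entire of order `< 2` (hence of growth `(2, 0)`), not identically zero (the printed
theorem tacitly excludes `f ≡ 0`, for which (1.1) is void and the conclusion fails), real on `ℝ`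
and even, whose
nonzero real zeros `b` (with multiplicity) satisfy `∑ b⁻² < ∞` (4.10). If `fℝ = (t ↦ Re f(t))` has
no critical point in Fourier's sense (`HasNoFourierCriticalPoint`), then `f` has no nonreal zeros
("just as many critical points as couples of nonreal zeros", printed Thm 4.3 p. 63, whose proof
covers infinitely many nonreal zeros). A literal special case of the printed theorem; grounds
`Summit.RiemannHypothesis.RiemannHypothesis.Theses.EarlyAppointments.HereditaryLaguerre → RH`.
[cite: KiKim2000, Theorem 4.3] -/
def KiKim2000_thm_4_3_noCriticalPoints : Prop :=
  ∀ f : ℂ → ℂ, IsEntireOfOrderLt 2 f → (∃ z : ℂ, f z ≠ 0) → IsRealOnReal f →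
    (∀ z : ℂ, f (-z) = f z) →
    Summable (fun b : {x : ℝ // f (x : ℂ) = 0 ∧ x ≠ 0} =>
      (analyticOrderNatAt f ((b : ℝ) : ℂ) : ℝ) / (b : ℝ) ^ 2) →
    HasNoFourierCriticalPoint (fun t : ℝ => (f (t : ℂ)).re) →
    ∀ z : ℂ, f z = 0 → z.im = 0

end Literature.Analysis.Complex

end
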